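import Summits.Ventures.PercRepro.Graph
import Summits.Ventures.PercRepro.Classical

/-!
# PercRepro — the random partition of the marked vertices as a lattice element (typer-2, gen 2)

Built on typer-1's `Graph.lean` (`MultiGraph`, `G.Conn`, `G.connSetoid`, `G.connEvent`,
`G.sepEvent`, `G.partitionEvent m rgs`).

* `G.markedPartition ω m : Setoid (Fin k)` — the random partition `Π` of the marked vertices
  `m : Fin k → V` (engine: the marked line, in order). The order on `Setoid (Fin k)` is
  refinement (`σ ≤ τ` iff `σ` refines `τ`; `⊥` = all singletons, `⊤` = one block; `⊔` = join,
  `⊓` = meet), as in PLAN.md §0.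
* `G.partitionSetoidEvent m σ = {Π = σ}` (one engine law row, lattice form; the engine's
  restricted-growth-string row `G.partitionEvent m rgs` is the case `σ = Setoid.ker rgs`),
  `G.partitionIn m X = {Π ∈ X}`.
* Monotonicity: `G.markedPartition_mono`, `Π(ω ⊔ ω') ≥ Π(ω) ⊔ Π(ω')`, `Π(ω ⊓ ω') ≤ Π(ω) ⊓ Π(ω')`
  (unmarked vertices can only coarsen joins / refine meets).
* `ahlswede_daykin_partition` — the classical cone's (K1) (PLAN.md §1), PROVED from Mathlib's four
  functions theorem: for all `X Y ⊆ Part(M)`,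
  `P(Π ∈ X) · P(Π ∈ Y) ≤ P(Π ∈ ↑(X ∨ Y)) · P(Π ∈ ↓(X ∧ Y))`.
-/

namespace PercRepro

namespace MultiGraph

variable {V E : Type*} (G : MultiGraph V E)

/-! ### The random partition of the marked vertices -/

/-- The random partition `Π` of the marked vertices `m : Fin k → V` (engine: the marked line, in
order) induced by open-cluster connectivity, as a setoid on the indices `Fin k`. -/
def markedPartition (ω : Config E) {k : ℕ} (m : Fin k → V) : Setoid (Fin k) :=
  Setoid.comap m (G.connSetoid ω)

/-- Reading off the marked partition: `i ~ j` iff `m i ↔ m j`. -/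
lemma markedPartition_rel (ω : Config E) {k : ℕ} (m : Fin k → V) (i j : Fin k) :
    G.markedPartition ω m i j ↔ G.Conn ω (m i) (m j) := Iff.rfl

/-- Opening edges coarsens the marked partition. -/
lemma markedPartition_mono {k : ℕ} (m : Fin k → V) :
    Monotone fun ω => G.markedPartition ω m := fun ω ω' h =>
  Setoid.le_def.2 fun {i j} hij =>
    (G.markedPartition_rel ω' m i j).2 (Conn.mono h ((G.markedPartition_rel ω m i j).1 hij))

/-- `Π(ω ⊔ ω') ≥ Π(ω) ⊔ Π(ω')`: unmarked vertices can only coarsen the join. -/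
lemma sup_markedPartition_le (ω ω' : Config E) {k : ℕ} (m : Fin k → V) :
    G.markedPartition ω m ⊔ G.markedPartition ω' m ≤ G.markedPartition (ω ⊔ ω') m :=
  sup_le (G.markedPartition_mono m le_sup_left) (G.markedPartition_mono m le_sup_right)

/-- `Π(ω ⊓ ω') ≤ Π(ω) ⊓ Π(ω')`. -/
lemma markedPartition_inf_le (ω ω' : Config E) {k : ℕ} (m : Fin k → V) :
    G.markedPartition (ω ⊓ ω') m ≤ G.markedPartition ω m ⊓ G.markedPartition ω' m :=
  le_inf (G.markedPartition_mono m inf_le_left) (G.markedPartition_mono m inf_le_right)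

/-- The partition event `{Π = σ}` in lattice form — one row of the engine's `--law` output. -/
def partitionSetoidEvent {k : ℕ} (m : Fin k → V) (σ : Setoid (Fin k)) : Set (Config E) :=
  {ω | G.markedPartition ω m = σ}

/-- The engine's restricted-growth-string row is the lattice row of the kernel of the labels. -/
lemma partitionEvent_eq_partitionSetoidEvent {k : ℕ} (m : Fin k → V) (rgs : Fin k → ℕ) :
    G.partitionEvent m rgs = G.partitionSetoidEvent m (Setoid.ker rgs) := by
  ext ω
  simp only [partitionEvent, partitionSetoidEvent, Set.mem_setOf_eq]
  constructor
  · intro h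
    exact Setoid.ext fun i j => by
      rw [Setoid.ker_def]
      exact (G.markedPartition_rel ω m i j).trans (h i j)
  · intro h i j
    rw [← Setoid.ker_def, ← h]
    exact (G.markedPartition_rel ω m i j).symm

/-- The event `{Π ∈ X}` for a set `X` of partitions. -/
def partitionIn {k : ℕ} (m : Fin k → V) (X : Set (Setoid (Fin k))) : Set (Config E) :=
  {ω | G.markedPartition ω m ∈ X}

/-- `{Π ∈ {σ}}` is the row `{Π = σ}`. -/
lemma partitionIn_singleton {k : ℕ} (m : Fin k → V) (σ : Setoid (Fin k)) :
    G.partitionIn m {σ} = G.partitionSetoidEvent m σ := rfl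

/-- The connection event `{m i ↔ m j}` is the partition event `{Π ∈ {σ | σ i j}}`. -/
lemma connEvent_eq_partitionIn {k : ℕ} (m : Fin k → V) (i j : Fin k) :
    G.connEvent (m i) (m j) = G.partitionIn m {σ | σ i j} := rfl

/-- `{Π ∈ X}` is increasing for an up-set `X` of partitions. -/
lemma isUpperSet_partitionIn {k : ℕ} (m : Fin k → V) {X : Set (Setoid (Fin k))}
    (hX : IsUpperSet X) : IsUpperSet (G.partitionIn m X) :=
  fun _ _ h hω => hX (G.markedPartition_mono m h) hω

/-- `{Π ∈ X}` is decreasing for a down-set `X` of partitions. -/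
lemma isLowerSet_partitionIn {k : ℕ} (m : Fin k → V) {X : Set (Setoid (Fin k))}
    (hX : IsLowerSet X) : IsLowerSet (G.partitionIn m X) :=
  fun _ _ h hω => hX (G.markedPartition_mono m h) hω

/-! ### The classical cone: (K1) Ahlswede–Daykin in partition form -/

section AD

variable [Fintype E] [DecidableEq E]

omit [DecidableEq E] in
/-- The pointwise four-functions inequality behind `ahlswede_daykin_partition`. -/
lemma ad_pointwise {p : E → ℝ} (hp : IsProb p) {k : ℕ} (m : Fin k → V)
    (X Y : Set (Setoid (Fin k))) (a b : Config E) :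
    (G.partitionIn m X).indicator (weight p) a * (G.partitionIn m Y).indicator (weight p) b ≤
      (G.partitionIn m (lowerClosure (Set.image2 (· ⊓ ·) X Y))).indicator (weight p) (a ⊓ b) *
        (G.partitionIn m (upperClosure (Set.image2 (· ⊔ ·) X Y))).indicator (weight p) (a ⊔ b) := by
  by_cases ha : a ∈ G.partitionIn m X
  · by_cases hb : b ∈ G.partitionIn m Y
    · have ha' : G.markedPartition a m ∈ X := ha
      have hb' : G.markedPartition b m ∈ Y := hb
      have hinf : a ⊓ b ∈ G.partitionIn m (lowerClosure (Set.image2 (· ⊓ ·) X Y)) := by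
        show G.markedPartition (a ⊓ b) m ∈ (lowerClosure (Set.image2 (· ⊓ ·) X Y) : Set _)
        rw [SetLike.mem_coe, mem_lowerClosure]
        exact ⟨_, Set.mem_image2_of_mem ha' hb', G.markedPartition_inf_le a b m⟩
      have hsup : a ⊔ b ∈ G.partitionIn m (upperClosure (Set.image2 (· ⊔ ·) X Y)) := by
        show G.markedPartition (a ⊔ b) m ∈ (upperClosure (Set.image2 (· ⊔ ·) X Y) : Set _)
        rw [SetLike.mem_coe, mem_upperClosure]
        exact ⟨_, Set.mem_image2_of_mem ha' hb', G.sup_markedPartition_le a b m⟩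
      rw [Set.indicator_of_mem ha, Set.indicator_of_mem hb, Set.indicator_of_mem hinf,
        Set.indicator_of_mem hsup, weight_inf_mul_weight_sup]
    · rw [Set.indicator_of_notMem hb, mul_zero]
      exact mul_nonneg (Set.indicator_nonneg (fun ω _ => weight_nonneg hp ω) _)
        (Set.indicator_nonneg (fun ω _ => weight_nonneg hp ω) _)
  · rw [Set.indicator_of_notMem ha, zero_mul]
    exact mul_nonneg (Set.indicator_nonneg (fun ω _ => weight_nonneg hp ω) _)
      (Set.indicator_nonneg (fun ω _ => weight_nonneg hp ω) _)

/-- **(K1) Ahlswede–Daykin / Harris–FKG in partition form** (PLAN.md §1): for all sets `X`, `Y` of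
partitions of the marked vertices,
`P(Π ∈ X) · P(Π ∈ Y) ≤ P(Π ∈ ↑(X ∨ Y)) · P(Π ∈ ↓(X ∧ Y))`,
where `X ∨ Y = {σ ⊔ τ | σ ∈ X, τ ∈ Y}`, `X ∧ Y = {σ ⊓ τ | σ ∈ X, τ ∈ Y}` and `↑` / `↓` are the
up- / down-closures in the refinement order. Proved from Mathlib's four functions theorem
(`four_functions_theorem_univ`) using log-modularity of the product weight and
`Π(ω ⊔ ω') ≥ Π(ω) ⊔ Π(ω')`, `Π(ω ⊓ ω') ≤ Π(ω) ⊓ Π(ω')`. -/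
theorem ahlswede_daykin_partition {p : E → ℝ} (hp : IsProb p) {k : ℕ} (m : Fin k → V)
    (X Y : Set (Setoid (Fin k))) :
    prob p (G.partitionIn m X) * prob p (G.partitionIn m Y) ≤
      prob p (G.partitionIn m (upperClosure (Set.image2 (· ⊔ ·) X Y))) *
        prob p (G.partitionIn m (lowerClosure (Set.image2 (· ⊓ ·) X Y))) := by
  unfold prob
  rw [mul_comm (∑ ω, (G.partitionIn m (upperClosure (Set.image2 (· ⊔ ·) X Y))).indicator
    (weight p) ω)]
  exact four_functions_theorem_univ _ _ _ _
    (fun ω => Set.indicator_nonneg (fun ω' _ => weight_nonneg hp ω') ω)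
    (fun ω => Set.indicator_nonneg (fun ω' _ => weight_nonneg hp ω') ω)
    (fun ω => Set.indicator_nonneg (fun ω' _ => weight_nonneg hp ω') ω)
    (fun ω => Set.indicator_nonneg (fun ω' _ => weight_nonneg hp ω') ω)
    (G.ad_pointwise hp m X Y)

/-- The up-set/up-set case of (K1) is the Harris inequality for partition events. -/
theorem harris_partitionIn {p : E → ℝ} (hp : IsProb p) {k : ℕ} (m : Fin k → V)
    {X Y : Set (Setoid (Fin k))} (hX : IsUpperSet X) (hY : IsUpperSet Y) :
    prob p (G.partitionIn m X) * prob p (G.partitionIn m Y) ≤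
      prob p (G.partitionIn m X ∩ G.partitionIn m Y) :=
  harris hp (G.isUpperSet_partitionIn m hX) (G.isUpperSet_partitionIn m hY)

end AD

/-! ### The five law rows of three marked vertices as connection events -/

section Rows3

variable {ω : Config E} (a b c : V)

/-- Membership in a `k = 3` partition row reduces to the three atoms `a~b`, `a~c`, `b~c`. -/
theorem mem_partitionEvent_three (r : Fin 3 → ℕ) :
    ω ∈ G.partitionEvent ![a, b, c] r ↔
      (G.Conn ω a b ↔ r 0 = r 1) ∧ (G.Conn ω a c ↔ r 0 = r 2) ∧ (G.Conn ω b c ↔ r 1 = r 2) := by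
  constructor
  · intro h
    exact ⟨h 0 1, h 0 2, h 1 2⟩
  · rintro ⟨hab, hac, hbc⟩ i j
    have hba : G.Conn ω b a ↔ r 1 = r 0 := by rw [G.conn_comm, hab, eq_comm]
    have hca : G.Conn ω c a ↔ r 2 = r 0 := by rw [G.conn_comm, hac, eq_comm]
    have hcb : G.Conn ω c b ↔ r 2 = r 1 := by rw [G.conn_comm, hbc, eq_comm]
    fin_cases i <;> fin_cases j <;> simp [hab, hac, hbc, hba, hca, hcb, Conn.refl]

/-- The three transitivity facts among `a~b`, `a~c`, `b~c` (used by `tauto` below). -/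
theorem conn_three_trans :
    (G.Conn ω a b → G.Conn ω b c → G.Conn ω a c) ∧
      (G.Conn ω a b → G.Conn ω a c → G.Conn ω b c) ∧
        (G.Conn ω a c → G.Conn ω b c → G.Conn ω a b) :=
  ⟨fun h h' => h.trans h', fun h h' => h.symm.trans h', fun h h' => h.trans h'.symm⟩

/-- Row `000`: `abc`, i.e. `a~b ∧ b~c`. -/
theorem partitionEvent_row_abc :
    G.partitionEvent ![a, b, c] ![0, 0, 0] = G.connEvent a b ∩ G.connEvent b c := by
  ext ω
  obtain ⟨h1, h2, h3⟩ := G.conn_three_trans a b c (ω := ω)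
  simp only [mem_partitionEvent_three, Set.mem_inter_iff, mem_connEvent]
  simp
  tauto

/-- Row `001`: `ab|c`, i.e. `a~b ∧ a≁c`. -/
theorem partitionEvent_row_ab_c :
    G.partitionEvent ![a, b, c] ![0, 0, 1] = G.connEvent a b ∩ G.sepEvent a c := by
  ext ω
  obtain ⟨h1, h2, h3⟩ := G.conn_three_trans a b c (ω := ω)
  simp only [mem_partitionEvent_three, Set.mem_inter_iff, mem_connEvent, mem_sepEvent]
  simp
  tauto

/-- Row `010`: `ac|b`, i.e. `a~c ∧ a≁b`. -/
theorem partitionEvent_row_ac_b :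
    G.partitionEvent ![a, b, c] ![0, 1, 0] = G.connEvent a c ∩ G.sepEvent a b := by
  ext ω
  obtain ⟨h1, h2, h3⟩ := G.conn_three_trans a b c (ω := ω)
  simp only [mem_partitionEvent_three, Set.mem_inter_iff, mem_connEvent, mem_sepEvent]
  simp
  tauto

/-- Row `011`: `bc|a`, i.e. `b~c ∧ a≁b`. -/
theorem partitionEvent_row_bc_a :
    G.partitionEvent ![a, b, c] ![0, 1, 1] = G.connEvent b c ∩ G.sepEvent a b := by
  ext ω
  obtain ⟨h1, h2, h3⟩ := G.conn_three_trans a b c (ω := ω)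
  simp only [mem_partitionEvent_three, Set.mem_inter_iff, mem_connEvent, mem_sepEvent]
  simp
  tauto

/-- Row `012`: `a|b|c`, i.e. `a≁b ∧ a≁c ∧ b≁c`. -/
theorem partitionEvent_row_a_b_c :
    G.partitionEvent ![a, b, c] ![0, 1, 2] = G.sepEvent a b ∩ G.sepEvent a c ∩ G.sepEvent b c := by
  ext ω
  simp only [mem_partitionEvent_three, Set.mem_inter_iff, mem_sepEvent]
  simp
  tauto

end Rows3

end MultiGraph

end PercRepro
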